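import Mathlib.Algebra.Group.Subgroup.Basic
import Mathlib.Algebra.Group.Pointwise.Finset.Basic
import Mathlib.Data.Finset.NAry
import Mathlib.Tactic
import Literature.Combinatorics.Additive.TripleProductProperty
import Literature.Computability.AlgebraicComplexity.CohnUmansTPP
import HarnessLib

/-!
# Lifting TPP triples along an injective homomorphism and a right transversal

If `f : K →* G` is injective, `(S, T, U)` satisfies the triple product property in `K` (the tree's right-quotient
form, as in `RealizesTPP`), and `R ⊆ G` is a partial right transversal of the image (`r * r'⁻¹ ∈ range f` only for
`r = r'`), then `(f(S)·R, f(T), f(U))` satisfies the TPP in `G` and has `|S|·|R|, |T|, |U|` elements.  In particular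
`β(G) ≥ [G:H]·β(H)` for every subgroup `H ≤ G` (take `f = H.subtype` and `R` a full right transversal), and TPP
capacities are super-multiplicative along subgroup chains.  This is the certificate format behind the lane's
"subgroup lifting" census bounds (speedrun tpp, seat sr-tpp-search-g10, `py/lift10.py`): each bound names a census
group `H` of order ≤ 127 with exactly known `β(H)`, an explicit embedding into `G` and a right transversal.
-/

namespace Summit.MatrixMultiplication.OmegaCensus.SubgroupLiftTPP

open Literature.Computability.AlgebraicComplexity

variable {K G : Type*} [Group K] [Group G]

/-- group-theoretic rearrangement used twice below. -/
theorem quot_eq_of_eq_one {a a' r r' Q : G} (h : a * r * (a' * r')⁻¹ * Q = 1) :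
    r * r'⁻¹ = a⁻¹ * (Q⁻¹ * a') := by
  calc r * r'⁻¹ = a⁻¹ * (a * r * (a' * r')⁻¹ * Q) * (Q⁻¹ * a') := by group
    _ = a⁻¹ * (Q⁻¹ * a') := by rw [h]; group

/-- **TPP lifting.** `f` injective, `R` a partial right transversal of `range f`, `(S,T,U)` TPP in `K` ⇒
`(f(S)·R, f(T), f(U))` TPP in `G`. -/
theorem tpp_lift [DecidableEq G] (f : K →* G) (hf : Function.Injective f)
    {S T U : Finset K} {R : Finset G}
    (hR : ∀ r ∈ R, ∀ r' ∈ R, r * r'⁻¹ ∈ Set.range f → r = r')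
    (h : ∀ s ∈ S, ∀ s' ∈ S, ∀ t ∈ T, ∀ t' ∈ T, ∀ u ∈ U, ∀ u' ∈ U,
      s * s'⁻¹ * (t * t'⁻¹) * (u * u'⁻¹) = 1 → s = s' ∧ t = t' ∧ u = u') :
    ∀ x ∈ Finset.image₂ (fun s r => f s * r) S R, ∀ x' ∈ Finset.image₂ (fun s r => f s * r) S R,
      ∀ y ∈ T.image f, ∀ y' ∈ T.image f, ∀ z ∈ U.image f, ∀ z' ∈ U.image f,
      x * x'⁻¹ * (y * y'⁻¹) * (z * z'⁻¹) = 1 → x = x' ∧ y = y' ∧ z = z' := by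
  intro x hx x' hx' y hy y' hy' z hz z' hz' heq
  simp only [Finset.mem_image₂, Finset.mem_image] at hx hx' hy hy' hz hz'
  obtain ⟨s, hs, r, hr, rfl⟩ := hx
  obtain ⟨s', hs', r', hr', rfl⟩ := hx'
  obtain ⟨t, ht, rfl⟩ := hy
  obtain ⟨t', ht', rfl⟩ := hy'
  obtain ⟨u, hu, rfl⟩ := hz
  obtain ⟨u', hu', rfl⟩ := hz'
  set q : K := t * t'⁻¹ * (u * u'⁻¹) with hq
  have hQ : f t * (f t')⁻¹ * (f u * (f u')⁻¹) = f q := by simp [hq, map_mul, map_inv]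
  have heq' : f s * r * (f s' * r')⁻¹ * f q = 1 := by
    rw [← hQ]; simpa [mul_assoc] using heq
  have hrr : r * r'⁻¹ = f (s⁻¹ * (q⁻¹ * s')) := by
    rw [quot_eq_of_eq_one heq']; simp [map_mul, map_inv]
  have hr_eq : r = r' := hR r hr r' hr' ⟨_, hrr.symm⟩
  subst hr_eq
  have h1 : f (s * s'⁻¹ * q) = 1 := by
    have : f s * r * (f s' * r)⁻¹ = f s * (f s')⁻¹ := by group
    rw [this] at heq'
    simpa [map_mul, map_inv] using heq'
  have h2 : s * s'⁻¹ * (t * t'⁻¹) * (u * u'⁻¹) = 1 := by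
    have : s * s'⁻¹ * (t * t'⁻¹) * (u * u'⁻¹) = s * s'⁻¹ * q := by simp only [hq, mul_assoc]
    rw [this]; exact hf (by rw [h1, map_one])
  obtain ⟨rfl, rfl, rfl⟩ := h s hs s' hs' t ht t' ht' u hu u' hu' h2
  exact ⟨rfl, rfl, rfl⟩

/-- the lifted first set has `|S|·|R|` elements. -/
theorem card_lift [DecidableEq G] (f : K →* G) (hf : Function.Injective f)
    (S : Finset K) {R : Finset G} (hR : ∀ r ∈ R, ∀ r' ∈ R, r * r'⁻¹ ∈ Set.range f → r = r') :
    (Finset.image₂ (fun s r => f s * r) S R).card = S.card * R.card := by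
  rw [Finset.card_image₂_iff]
  rintro ⟨s, r⟩ hsr ⟨s', r'⟩ hsr' he
  simp only [Set.mem_prod, Finset.mem_coe] at hsr hsr'
  simp only at he
  have hrr : r * r'⁻¹ = f (s⁻¹ * s') := by
    have h1 : f s * r * (f s' * r')⁻¹ * 1 = 1 := by rw [he]; group
    rw [quot_eq_of_eq_one h1]; simp [map_mul, map_inv]
  have hr : r = r' := hR r hsr.2 r' hsr'.2 ⟨_, hrr.symm⟩
  subst hr
  have : f s = f s' := mul_right_cancel he
  simp [hf this]

/-- **Capacity lifting**: `RealizesTPP K a b c`, `f : K →* G` injective and a partial right transversal `R` of the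
image give `RealizesTPP G (a·|R|) b c`.  With `R` a full right transversal of a subgroup `H` (so `|R| = [G:H]`):
`β(G) ≥ [G:H]·β(H)`. -/
theorem realizesTPP_lift [DecidableEq G] (f : K →* G) (hf : Function.Injective f)
    (R : Finset G) (hR : ∀ r ∈ R, ∀ r' ∈ R, r * r'⁻¹ ∈ Set.range f → r = r')
    {a b c : ℕ} (h : RealizesTPP K a b c) : RealizesTPP G (a * R.card) b c := by
  obtain ⟨S, T, U, hS, hT, hU, htpp⟩ := h
  refine ⟨Finset.image₂ (fun s r => f s * r) S R, T.image f, U.image f, ?_, ?_, ?_, tpp_lift f hf hR htpp⟩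
  · rw [card_lift f hf S hR, hS]
  · rw [Finset.card_image_of_injective _ hf, hT]
  · rw [Finset.card_image_of_injective _ hf, hU]

/-- Subgroup form: a TPP triple of a subgroup `H` (as a group in its own right) and a partial right transversal
`R` of `H` in `G` (`r * r'⁻¹ ∈ H → r = r'`) give a TPP triple of `G` with the first size multiplied by `|R|`. -/
theorem realizesTPP_lift_subgroup [DecidableEq G] (H : Subgroup G)
    (R : Finset G) (hR : ∀ r ∈ R, ∀ r' ∈ R, r * r'⁻¹ ∈ H → r = r')
    {a b c : ℕ} (h : RealizesTPP H a b c) : RealizesTPP G (a * R.card) b c := by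
  refine realizesTPP_lift H.subtype H.subtype_injective R ?_ h
  intro r hr r' hr' hmem
  apply hR r hr r' hr'
  obtain ⟨x, hx⟩ := hmem
  rw [← hx]; exact x.2

end Summit.MatrixMultiplication.OmegaCensus.SubgroupLiftTPP
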